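import Mathlib
import Literature.NumberTheory.LFunctions.Zhang2022.Section4PartialIntegration
import HarnessLib

/-!
# Zhang (2022), §4: the partial-summation device with a general differentiable weight —
# `Σ_{a<n≤b} c(n)f(n) = f(b)X_a(b) − ∫_a^b X_a(x)f′(x)dx` and its bound by `|X_a(b)|`, `∫|X_a|dx/x`

Topic `Literature/NumberTheory/LFunctions/Zhang2022` (Landau–Siegel adjudication tree;
verdict-neutral). Y. Zhang, *Discrete mean estimates and the Landau–Siegel zero*,
arXiv:2211.02515v1 (2022) [Zhang2022LandauSiegel] — **an unrefereed manuscript under adjudication**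
— §4, proof of Lemma 4.4, p. 19 (tex L1062–L1066):

> By (3.5) and partial summation, the second sum on the right side above is
> `= ∫_{D⁴}^{P²} g(P^{9/5}/x) x^{s₀−s} dX₃(x,ψ) ≪ 𝓛₁(|X₃(P²,ψ)| + ∫_{D⁴}^{P²} |X₃(x,ψ)| x⁻¹dx) ≪ 𝓛⁻¹⁸⁰`.

The tree's `Section4PartialIntegration` (`Lemma41.sum_mul_cpow_eq`, `Lemma41.norm_sum_mul_cpow_le`)
treats the weight `x^{z}` only ("the weight `g(P^{9/5}/x)` version used before (4.7) is not treated"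
— its module docstring). This file PROVES the same Stieltjes / partial-integration device for an
ARBITRARY weight `f : ℝ → ℂ` differentiable on `[a, b]` with continuous derivative `f′`
(`0 < a ≤ b`; `X_a(x) = Σ_{a<n≤x} c(n)` is the tree's `Lemma41.Xsum c a x`):

* `Section4.sum_mul_weight_eq` — **EXACT**: `Σ_{a<n≤b} c(n)f(n) = f(b)X_a(b) − ∫_a^b X_a(x)f′(x)dx`
  (Mathlib's Abel summation `sum_mul_eq_sub_sub_integral_mul`);
* `Section4.norm_sum_mul_weight_le` — **the bound**: if `|f(b)| ≤ A` and `x|f′(x)| ≤ B` on `[a,b]`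
  then `|Σ_{a<n≤b} c(n)f(n)| ≤ A|X_a(b)| + B∫_a^b |X_a(x)|x⁻¹dx`;
* the integrability lemmas `Section4.intervalIntegrable_Xsum_mul` (`X_a·h` for `h` continuous) and
  `Section4.intervalIntegrable_norm_Xsum_div` (`|X_a(x)|/x`).

The application to the weight `f(x) = g(P^{9/5}/x)x^{s₀−s}` (the manuscript's display, node
`Section4.GSumBound` of `Section4Statements`) is the sibling file `Section4GSumBound.lean`.
Nothing about Theorems 1–2 of the source or about Landau–Siegel zeros is stated or implied.

## References

* Y. Zhang, arXiv:2211.02515v1 (2022), §4 p. 19 (proof of Lemma 4.4, the display after the line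
  `Re w = 1`). [cite: Zhang2022LandauSiegel, §4 Lemma 4.4 (proof) p. 19]
* Mathlib, `Mathlib/NumberTheory/AbelSummation.lean` (`sum_mul_eq_sub_sub_integral_mul`,
  `integrableOn_mul_sum_Icc`).
-/

noncomputable section

open Complex Real Set MeasureTheory Finset intervalIntegral

namespace Literature.NumberTheory.LFunctions.Zhang2022.Section4

open Lemma41 (Xsum Xsum_def Xsum_eq_sum_Ioc Xsum_self)

/-! ### Truncated coefficients (the tree's private bookkeeping, reproduced without a definition) -/

/-- Full partial sums of the coefficients truncated to `k > m`. [folklore] -/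
private lemma sum_Icc_ctrunc (c : ℕ → ℂ) (m n : ℕ) :
    ∑ k ∈ Finset.Icc 0 n, (if m < k then c k else 0) = ∑ k ∈ Finset.Icc (m + 1) n, c k := by
  rw [← Finset.sum_filter]
  congr 1
  ext k
  simp only [Finset.mem_filter, Finset.mem_Icc]
  omega

/-! ### Integrability of the step function against continuous weights -/

/-- `X_a(x)·h(x)` is integrable on `[a, b]` for `h` continuous on `[a, b]`, `a ≥ 0`
(Mathlib `integrableOn_mul_sum_Icc`; the Stieltjes integrals `∫ h dX` of the manuscript exist).
[cite: Zhang2022LandauSiegel, §4 Lemma 4.4 (proof) p. 19] -/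
theorem intervalIntegrable_Xsum_mul (c : ℕ → ℂ) {a b : ℝ} (ha : 0 ≤ a) (hab : a ≤ b)
    {h : ℝ → ℂ} (hh : ContinuousOn h (Set.Icc a b)) :
    IntervalIntegrable (fun x : ℝ => Xsum c a x * h x) volume a b := by
  rw [intervalIntegrable_iff_integrableOn_Icc_of_le hab]
  have hI := integrableOn_mul_sum_Icc c ha hh.integrableOn_Icc (b := b)
    (m := ⌊a⌋₊ + 1)
  refine hI.congr_fun (fun x _ => ?_) measurableSet_Icc
  simp only [Xsum_def]; ring

/-- `|X_a(x)|/x` is integrable on `[a, b]`, `a > 0` (the manuscript's `∫_{D⁴}^{P²}|X₃(x,ψ)|x⁻¹dx`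
exists). [cite: Zhang2022LandauSiegel, §3 (3.5)] -/
theorem intervalIntegrable_norm_Xsum_div (c : ℕ → ℂ) {a b : ℝ} (ha : 0 < a) (hab : a ≤ b) :
    IntervalIntegrable (fun x : ℝ => ‖Xsum c a x‖ / x) volume a b := by
  rw [intervalIntegrable_iff_integrableOn_Icc_of_le hab]
  have hg : ContinuousOn (fun x : ℝ => ((x : ℂ))⁻¹) (Set.Icc a b) :=
    Complex.continuous_ofReal.continuousOn.inv₀
      fun x hx => Complex.ofReal_ne_zero.mpr (ha.trans_le hx.1).ne'
  have h : IntegrableOn (fun x : ℝ => ‖((x : ℂ))⁻¹ * ∑ k ∈ Finset.Icc (⌊a⌋₊ + 1) ⌊x⌋₊, c k‖)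
      (Set.Icc a b) :=
    MeasureTheory.Integrable.norm (integrableOn_mul_sum_Icc c ha.le hg.integrableOn_Icc (b := b))
  refine h.congr_fun (fun x hx => ?_) measurableSet_Icc
  have hx : 0 < x := ha.trans_le hx.1
  simp only [Xsum_def]
  rw [norm_mul, norm_inv, Complex.norm_real, Real.norm_eq_abs, abs_of_pos hx, inv_mul_eq_div]

/-! ### The identity -/

/-- **"By … partial summation, `Σ c(n) w(n) = ∫ w(x) dX(x)`" integrated by parts, EXACT, for a
general weight**: for `0 < a ≤ b` and `f` with derivative `f′` continuous on `[a, b]`,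
`Σ_{a<n≤b} c(n)f(n) = f(b)X_a(b) − ∫_a^b X_a(x)f′(x)dx` (`X_a(a) = 0`).
[cite: Zhang2022LandauSiegel, §4 Lemma 4.4 (proof) p. 19] -/
theorem sum_mul_weight_eq (c : ℕ → ℂ) {a b : ℝ} (ha : 0 < a) (hab : a ≤ b) {f f' : ℝ → ℂ}
    (hf : ∀ x ∈ Set.Icc a b, HasDerivAt f (f' x) x) (hf' : ContinuousOn f' (Set.Icc a b)) :
    ∑ n ∈ Finset.Ioc ⌊a⌋₊ ⌊b⌋₊, c n * f n
      = f b * Xsum c a b - ∫ x in a..b, Xsum c a x * f' x := by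
  have hdiff : ∀ t ∈ Set.Icc a b, DifferentiableAt ℝ f t := fun t ht => (hf t ht).differentiableAt
  have hderiv : Set.EqOn f' (deriv f) (Set.Icc a b) := fun t ht => ((hf t ht).deriv).symm
  have hint : IntegrableOn (deriv f) (Set.Icc a b) :=
    hf'.integrableOn_Icc.congr_fun hderiv measurableSet_Icc
  have hA := sum_mul_eq_sub_sub_integral_mul (fun k => if ⌊a⌋₊ < k then c k else 0) ha.le hab
    hdiff hint
  have hL : ∑ k ∈ Finset.Ioc ⌊a⌋₊ ⌊b⌋₊, f k * (fun k => if ⌊a⌋₊ < k then c k else 0) k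
      = ∑ n ∈ Finset.Ioc ⌊a⌋₊ ⌊b⌋₊, c n * f n := by
    refine Finset.sum_congr rfl fun k hk => ?_
    rw [Finset.mem_Ioc] at hk
    simp only [if_pos hk.1]
    ring
  rw [hL, sum_Icc_ctrunc, sum_Icc_ctrunc, ← intervalIntegral.integral_of_le hab] at hA
  rw [hA]
  have hI : ∫ t in a..b, deriv f t * ∑ k ∈ Finset.Icc 0 ⌊t⌋₊, (if ⌊a⌋₊ < k then c k else 0)
      = ∫ t in a..b, Xsum c a t * f' t := by
    refine intervalIntegral.integral_congr fun t ht => ?_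
    rw [Set.uIcc_of_le hab] at ht
    simp only [sum_Icc_ctrunc, ← Xsum_def]
    rw [← hderiv ht]; ring
  rw [hI]
  simp only [← Xsum_def]
  rw [Xsum_self, mul_zero, sub_zero]

/-! ### The bound -/

/-- **The partial-summation bound with a general weight** (the "`≪ 𝓛₁(|X₃(P²,ψ)| +
∫_{D⁴}^{P²}|X₃(x,ψ)|x⁻¹dx)`" step, with both suprema explicit): for `0 < a ≤ b`, `f` with
continuous derivative `f′` on `[a, b]`, `|f(b)| ≤ A`, and `x·|f′(x)| ≤ B` on `[a, b]`:
`|Σ_{a<n≤b} c(n)f(n)| ≤ A|X_a(b)| + B∫_a^b |X_a(x)|x⁻¹dx`.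
[cite: Zhang2022LandauSiegel, §4 Lemma 4.4 (proof) p. 19] -/
theorem norm_sum_mul_weight_le (c : ℕ → ℂ) {a b : ℝ} (ha : 0 < a) (hab : a ≤ b) {f f' : ℝ → ℂ}
    (hf : ∀ x ∈ Set.Icc a b, HasDerivAt f (f' x) x) (hf' : ContinuousOn f' (Set.Icc a b))
    {A B : ℝ} (hA : ‖f b‖ ≤ A) (hB : ∀ x ∈ Set.Icc a b, x * ‖f' x‖ ≤ B) :
    ‖∑ n ∈ Finset.Ioc ⌊a⌋₊ ⌊b⌋₊, c n * f n‖
      ≤ A * ‖Xsum c a b‖ + B * ∫ x in a..b, ‖Xsum c a x‖ / x := by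
  rw [sum_mul_weight_eq c ha hab hf hf']
  have hint1 : IntervalIntegrable (fun x : ℝ => Xsum c a x * f' x) volume a b :=
    intervalIntegrable_Xsum_mul c ha.le hab hf'
  have hint2 : IntervalIntegrable (fun x : ℝ => ‖Xsum c a x‖ / x) volume a b :=
    intervalIntegrable_norm_Xsum_div c ha hab
  have hpt : ∀ x ∈ Set.Icc a b, ‖Xsum c a x * f' x‖ ≤ B * (‖Xsum c a x‖ / x) := by
    intro x hx
    have hx0 : 0 < x := ha.trans_le hx.1
    rw [norm_mul]
    calc ‖Xsum c a x‖ * ‖f' x‖ = (‖Xsum c a x‖ / x) * (x * ‖f' x‖) := by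
          field_simp
      _ ≤ (‖Xsum c a x‖ / x) * B :=
          mul_le_mul_of_nonneg_left (hB x hx) (div_nonneg (norm_nonneg _) hx0.le)
      _ = B * (‖Xsum c a x‖ / x) := by ring
  have hI : ‖∫ x in a..b, Xsum c a x * f' x‖ ≤ B * ∫ x in a..b, ‖Xsum c a x‖ / x := by
    calc ‖∫ x in a..b, Xsum c a x * f' x‖
        ≤ ∫ x in a..b, ‖Xsum c a x * f' x‖ :=
          intervalIntegral.norm_integral_le_integral_norm hab
      _ ≤ ∫ x in a..b, B * (‖Xsum c a x‖ / x) :=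
          intervalIntegral.integral_mono_on hab hint1.norm (hint2.const_mul B) hpt
      _ = B * ∫ x in a..b, ‖Xsum c a x‖ / x := intervalIntegral.integral_const_mul B _
  calc ‖f b * Xsum c a b - ∫ x in a..b, Xsum c a x * f' x‖
      ≤ ‖f b * Xsum c a b‖ + ‖∫ x in a..b, Xsum c a x * f' x‖ := norm_sub_le _ _
    _ = ‖f b‖ * ‖Xsum c a b‖ + ‖∫ x in a..b, Xsum c a x * f' x‖ := by rw [norm_mul]
    _ ≤ A * ‖Xsum c a b‖ + B * ∫ x in a..b, ‖Xsum c a x‖ / x :=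
        add_le_add (mul_le_mul_of_nonneg_right hA (norm_nonneg _)) hI

end Literature.NumberTheory.LFunctions.Zhang2022.Section4

end
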